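import Mathlib
import HarnessLib
import Summits.HubbardSuperconductivity.HubbardSuperconductivity.Theorems.KLProgrammeKLRegimeSplitConsts

/-!
# Route `KLProgramme` — the frame class `FrameOK`, the two-leg pieces, and the per-scale predicates `BetaSplitAt`,
# `EngineBoundsAt`, `TwoLegStepAt` of the glued split of crux K3 `KLRegimeTwoPointLimit` (stmt-HubbardSuperconductivity-19937).
# Part 2 of 3; texts by p1b (HOME/prover-p1b/BETASPLIT-PRED.md), p1 (HOME/p1/ENGINE-PRED.md), p3 (HOME/p3/BetaSplitSketch.lean),
# assembled by p2 (owner, S3).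

Scale index `n : ℕ` (`h = -n`), `Λ_n = klScale klE0 n`, `γ = 4`; constants `G/P/Q/R` and majorants from Part 1
(`KLProgrammeKLRegimeSplitConsts.lean`).  Definitions only; nothing is asserted about the model.

* `FrameOK R U N μ K`: `e_K` has FST II geometric constants `GeomConstants (frameLevel μ K) 7 (3/80) (1/2) (3/200)` (the free
  band on `[-1, -0.15]` has `(4+|μ|, -μ/2, √(-μ/2·(4+3μ/2)), -μ/4)`, fs-1 `klfs_geomConstants`; halved) AND `K` is a sum of
  `N + 1` frame PIECES with the multiscale smoothness of BGM's dispersion increments ((2.36)/(2.42) shape): an engine at scale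
  `n` may move the pieces finer than `n` out of its propagator (same model, frame moved — `HubbardEffectiveActionCT` §4), i.e.
  run BGM's dynamical scheme internally; a frame meeting the renormalisation condition down to `h_β` carries the angular
  structure of all scales, and without the decomposition the scale-`h` sectorised propagator in the frame would have
  unbounded second tangential moments (p2 g3 scheme note, STATUS 05:58:30Z).
* `symInterp L f : TrigPolyC4v` — the `C₄ᵥ`-symmetrised trigonometric interpolant of a real function on the torus momenta
  (cosine coefficients grouped by `(|x̃₁|, |x̃₂|)`); `klTwoLegPoly … K n = D_n(K)` = the interpolant of the localised two-leg
  value `klLocSelfEnergyRe … n`, and the PIECES `klTwoLegPiece … K n` = `D_0 ⊖ K`, `D_n ⊖ D_{n-1}` (`fsub`): `Σ_{n ≤ N} ℓ_n = D_N ⊖ K`,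
  so the renormalisation condition «`D_N(K) ≈ 0`» is the fixed-point equation `K ≈ -Σ_n ℓ_n(K)` of child 2.

* `BetaSplitAt … G P Q K n` (C1; the Cooper / non-Cooper split of the running quartic kernel at scale `n`):
  (B1) the LOCALISED Cooper blocks `klLocBlockInf/Sup … n χ` (p3, `KLProgrammeLocalisedCooperDefs` — p1's carrier decision
  Q-E2, ACKed 05:47:40Z) lie in C2's Riccati envelopes built from the deterministic majorants (`abot0/atop0`, `Ecum/EcumP`,
  `Bcum`); (B2) the FIXED-tuple `L¹` line of BGM (2.71a)/(2.71b) `≤ Klam·|U|` (not D1's summed norm); (B3) non-Cooper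
  4-tuples frozen (`klIsoArray`, `coarsen`, `IsCooperClassAt`); (B4) first moments `≤ Cd·Klam·|U|·4ⁿ` (anisotropic tuples).
* `EngineBoundsAt … G P Q K n` (C5b; what the fermionic tree expansion for OUR action delivers at scale `n` from the split at
  the scales `< n`): (E0) symmetries of the scale-`n` self-energy; (E1) anisotropic sector norms of every `2p`-leg kernel
  (BGM Thm 2.1 (2.77), no `|h|`); (E2) the SCALAR one-scale cascade comparison
  of the localised block bottoms / tops per `D₄` channel (bubble mass in `[blo, bhi]`, remainder `≤ eremBar n`, drives
  `≤ driveBar/drivePBar`) — literally the `hx`-hypothesis of C2's `attractive_lower_envelope` / `repulsiveEnvelope_step`;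
  (E2′) increments at all ordered isotropic 4-tuples against the two-shell bubble gains `G.ppGain/phGain`; (E4) first
  moments.  (E5) = the constants are `(β, L, M, n, K)`-independent by construction; thresholds `Q.L0/Q.M0` in the children.
* `TwoLegStepAt … G P Q R K n` (C4a in the CT scheme, (E3)): the scale-`n` two-leg piece `klTwoLegPiece … K n` obeys the
  `|h|`-FREE increment sizes of BGM (2.36) up to order 4 (`twoLegBar`), the per-scale TANGENTIAL FLOOR `≥ -bflBar n·|t|²`
  along the level sets of `e_K` (DECOMP App. C: the umklapp-corner logarithm is convexity-ENHANCING, so only summable /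
  `O(|U|³)` junk is negative), and the frame-LIPSCHITZ bound `lipBar n` (summable to `O(|U|)`) — self-map + contraction
  input of child 2's inversion.

KNOWN DESIGN QUESTION (p2 → p1/p1b, recorded, not blocking the split): the restoration of (B2) at COOPER-class tuples needs
ENTRYWISE control of the resummed one-scale ladders; the block bottoms/tops of (B1)/(E2) are spectral data in the
sector-WEIGHTED space (`klLocCooperOp = Σ √w 𝒞 √w`, `w_ω̄ ≍ 4^{-n}`) and do not bound entries (`sup|𝒞| ≲ ‖A‖/min w`), so
BETASPLIT-PRED §4's «fixed-tuple L¹ ≤ envelope sups» is not available from (E2) as typed.  If child 1's prover needs an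
entrywise ladder clause (second-order ladder term explicit entry by entry, remainder entry-bounded by `eremBar`), it is ONE
more conjunct of `EngineBoundsAt` (append here + re-statement of children 1 and 3 by a route edit) — the predicates are
versioned by this module, v1 = p1's (E0)–(E4) without p2's earlier (E1′) «fixed-tuple from blocks» (withdrawn: false as a
per-scale engine output for the same reason).

References: BGM 2006 [arXiv:cond-mat/0507686] §2.7 (2.71), §2.8 (2.77), Thm 2.1, §3 (3.65)–(3.70); FKT «Single scale
analysis … Part 2» [arXiv:math-ph/0209042] Thm VI; HOME/DECOMP.md v7.2 App. C, App. E (E1–E5); the three seat texts.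
-/

noncomputable section

namespace Summit.HubbardSuperconductivity.HubbardSuperconductivity.Theorems.KLRegimeSplit

set_option linter.dupNamespace false -- summit = problem name (single-conjunct summit), D-0017

open scoped InnerProductSpace
open Real Finset Literature.MathematicalPhysics.QuantumLattice Literature.Probability.LatticeModels
open Literature.MathematicalPhysics.QuantumLattice.FermiRG
open Summit.HubbardSuperconductivity.HubbardSuperconductivity.Theorems.KLProgrammeLegKernels
open Summit.HubbardSuperconductivity.HubbardSuperconductivity.Theorems.CooperChannelRiccatiFlow
open Summit.HubbardSuperconductivity.HubbardSuperconductivity.Theorems.CooperVertexBlocks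
open Summit.HubbardSuperconductivity.HubbardSuperconductivity.Theorems.DispersionFlow

/-! ## §4 The symmetrised trigonometric interpolant and the two-leg pieces (`TrigPolyC4v`-valued) -/

/-- Coefficients of a frame, zero-extended beyond its degree. -/
def coeffExt (A : TrigPolyC4v) (m n : ℕ) : ℝ := if m ≤ A.degree ∧ n ≤ A.degree then A.coeff m n else 0

/-- Difference of two frames (degree the max, coefficients subtracted). -/
def fsub (A B : TrigPolyC4v) : TrigPolyC4v :=
  ⟨max A.degree B.degree, fun m n => coeffExt A m n - coeffExt B m n⟩

/-- A frame read on `Momentum = EuclideanSpace ℝ (Fin 2)` (where `gradient`/`hessQuad`/`GeomConstants` live). -/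
def evalM (A : TrigPolyC4v) (q : Momentum) : ℝ := A.eval (WithLp.ofLp q)

/-- The uniform distance of two frames on the Brillouin zone: `sup_p |K(p) - K'(p)|`. -/
def frameDist (K K' : TrigPolyC4v) : ℝ := ⨆ p : Fin 2 → ℝ, |K.eval p - K'.eval p|

section Interp

variable (L : ℕ) [NeZero L]

/-- The cosine (position-space) coefficients of a real function on the torus momenta:
`f_c(x) = L⁻² Σ_{k⃗} f(k⃗) cos(p_{k⃗} · x̃)`, `x̃` the centred representative (`ZMod.valMinAbs`). -/
def torusCosCoeff (f : TorusSite 2 L → ℝ) (x : TorusSite 2 L) : ℝ :=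
  ((L : ℝ) ^ 2)⁻¹ * ∑ k : TorusSite 2 L, f k * Real.cos (∑ i : Fin 2, latticeMomentum L k i * ((x i).valMinAbs : ℝ))

/-- **The `C₄ᵥ`-symmetrised trigonometric interpolant** of a real function on the torus momenta, as a frame: coefficient of
the harmonic `h_{m,n}` = the sum of the cosine coefficients over the sites with `(|x̃₁|, |x̃₂|) = (m, n)` (degree `L`).  For an
even, `C₄ᵥ`-invariant `f` it takes the value `f(k⃗)` at every lattice momentum `p_{k⃗}`; in general it interpolates the
`D₄`-average of `f`.  Its derivatives are controlled by the position-space moments `Σ_x |x̃|ʲ|f_c(x)|`. -/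
def symInterp (f : TorusSite 2 L → ℝ) : TrigPolyC4v :=
  ⟨L, fun m n => ∑ x : TorusSite 2 L,
    if ((x 0).valMinAbs.natAbs = m ∧ (x 1).valMinAbs.natAbs = n) then torusCosCoeff L f x else 0⟩

end Interp

section TwoLeg

variable (L M : ℕ) [NeZero L] [NeZero M]

/-- **`D_n(K)`** — the localised two-leg output of the scale-`n` action as a frame: the symmetrised interpolant of
`klLocSelfEnergyRe … n`. -/
def klTwoLegPoly (β U μ : ℝ) (K : TrigPolyC4v) (n : ℕ) : TrigPolyC4v :=
  symInterp L (klLocSelfEnergyRe L M β U μ K n)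

/-- **The scale-`n` two-leg PIECE `ℓ_n(K)`**: `D_0(K) ⊖ K` at `n = 0` (the UV step's output beyond the frame vertex),
`D_n(K) ⊖ D_{n-1}(K)` for `n ≥ 1`; so `Σ_{n ≤ N} ℓ_n = D_N ⊖ K =: S_N(K)` and the renormalisation condition «`D_N(K) ≈ 0`» reads
`K ≈ -Σ_n ℓ_n(K)` — the counterterm map of child 2, whose pieces are these. -/
def klTwoLegPiece (β U μ : ℝ) (K : TrigPolyC4v) (n : ℕ) : TrigPolyC4v :=
  if n = 0 then fsub (klTwoLegPoly L M β U μ K 0) K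
  else fsub (klTwoLegPoly L M β U μ K n) (klTwoLegPoly L M β U μ K (n - 1))

end TwoLeg

/-! ## §5 `FrameOK` — the a-priori class of admissible frames -/

/-- **`FrameOK R U N μ K`**: (i) the frame band `e_K = ε - μ - K` on `Momentum` (`frameLevel`, p2 g2) has the FST II geometric
constants `GeomConstants e_K 7 (3/80) (1/2) (3/200)` — all derivatives of order `≤ 2` bounded by `7`, `|∇e_K| ≥ 1/2` and
tangential Hessian `≥ (3/200)|t|²` on `{|e_K| < 3/80}` (half the free band's constants on the analysis window); (ii) `K` is the
sum of `N + 1` frame PIECES `Kp n`, the `n`-th having the multiscale smoothness of a scale-`n` dispersion increment: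
`‖Dʲ(Kp n)‖ ≤ Gfr j · uPow j U · 4^{(j-2)n}`, `j ≤ 4`.  Scale-free in `n`; `N` = the number of scales (`klTempScaleIdx β klE0`). -/
def FrameOK (R : RenConsts) (U : ℝ) (N : ℕ) (μ : ℝ) (K : TrigPolyC4v) : Prop :=
  GeomConstants (frameLevel μ K) 7 (3 / 80) (1 / 2) (3 / 200) ∧
  ∃ Kp : ℕ → TrigPolyC4v,
    (∀ p : Fin 2 → ℝ, K.eval p = ∑ n ∈ range (N + 1), (Kp n).eval p) ∧
    ∀ n ≤ N, ∀ j ≤ 4, ∀ q : Momentum,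
      ‖iteratedFDeriv ℝ j (evalM (Kp n)) q‖ ≤ R.Gfr j * uPow j U * (4 : ℝ) ^ (((j : ℤ) - 2) * n)

/-! ## §6 `BetaSplitAt` — (B1)–(B4) (p1b's text, p3's sketch, on the localised carrier) -/

section Split

variable (L M : ℕ) [NeZero L] [NeZero M]

/-- The fixed-tuple `L¹` size of an `(m+1)`-leg sectorised kernel with leg `0` pinned at `x₁`:
`ε_x^m Σ_{x₂,…} ‖W_Ω(x₁, x₂, …)‖` (`ε_x = imagTimeWeight β M`). [p3's sketch] -/
def fixedTupleL1 {N : ℕ} (β : ℝ) (m : ℕ) (W : (Fin (m + 1) → SectorLeg N) → (Fin (m + 1) → SpaceTimeIdx L M) → ℂ)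
    (Ω : Fin (m + 1) → SectorLeg N) (x₁ : SpaceTimeIdx L M) : ℝ :=
  imagTimeWeight β M ^ m * ∑ x : Fin m → SpaceTimeIdx L M, ‖W Ω (Matrix.vecCons x₁ x)‖

/-- Distance on a discrete circle of `N` points. [p3's sketch] -/
def circDist (N a b : ℕ) : ℕ := min ((a + N - b % N) % N) ((b + N - a % N) % N)

/-- The space-time torus distance `|x - y|_{β,L}` on `SpaceTimeIdx L M` (sup of the imaginary-time circle distance in units
`β/(2M)` and the two spatial lattice distances). [p3's sketch] -/
def spaceTimeDist (β : ℝ) (x y : SpaceTimeIdx L M) : ℝ :=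
  max (imagTimeWeight β M * (circDist (2 * M) x.1.val y.1.val : ℝ))
    (max (circDist L (x.2 0).val (y.2 0).val : ℝ) (circDist L (x.2 1).val (y.2 1).val : ℝ))

/-- **(B1)** Cooper blocks in the Riccati envelopes at scale `n` (DECOMP App. E Lemma E.4 / C2): for every channel `χ`, no onset
`(A₀(χ) + Ē_χ(n))·B̄_n < 1`, the attractive lower envelope below the localised block bottom, and the block top below its start
plus the repulsive budget — with the DETERMINISTIC majorants of §2 (the stage-`n` conclusion of C2's `attractive_lower_envelope`
with `b k := bhi`, `d k := ē_k + driveBar χ k`, and of `repulsiveEnvelope_step` with `b := 0`). -/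
def CooperBlocksInEnvelopes (G : GeoConsts) (P : SplitConsts) (Q : EngConsts) (β U μ : ℝ) (K : TrigPolyC4v) (n : ℕ) :
    Prop :=
  ∀ χ : D4Irrep,
    (abot0 G U χ + Ecum G P Q U β L χ n) * Bcum G n < 1 ∧
    attractiveEnvelope (abot0 G U χ + Ecum G P Q U β L χ n) (Bcum G n) ≤ klLocBlockInf L M β U μ K klE0 n χ ∧
    klLocBlockSup L M β U μ K klE0 n χ ≤ atop0 G U χ + EcumP G P Q U β L n

/-- **(B2)** the endpoint norm line at scale `n` (BGM (2.71a)/(2.71b) with `C ↦ Klam`, FIXED tuple — not D1's summed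
`klLegKernelNorm`, which carries the sector-count factors and belongs to the engine): for every isotropic, resp. anisotropic,
label 4-tuple in BGM's conservation set and every pinned point, the fixed-tuple `L¹` size of the quartic kernel is `≤ Klam·|U|`. -/
def EndpointNormLine (P : SplitConsts) (β U μ : ℝ) (K : TrigPolyC4v) (n : ℕ) : Prop :=
  (∀ Ω ∈ bgmSectorSet L M (klIsoFamily L M β μ K klE0 n) 4, ∀ x₁ : SpaceTimeIdx L M,
      fixedTupleL1 L M β 3 (klLegKernel L M β U μ K klE0 n 4) Ω x₁ ≤ P.Klam * |U|) ∧
  (∀ Ω ∈ bgmSectorSet L M (klAnisoFamily L M β μ K klE0 n) 4, ∀ x₁ : SpaceTimeIdx L M,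
      fixedTupleL1 L M β 3 (klAnisoLegKernel L M β U μ K klE0 n 4) Ω x₁ ≤ P.Klam * |U|)

/-- **(B3)** non-Cooper 4-tuples do not flow / exited ones are frozen (App. E E2 (a)(d)), at scale `n` with resolution offset
`t₀`: (a) a tuple outside the Cooper class at resolution `t₀` stays within `C_W U²` of its scale-`0` ancestor; (b) a tuple
leaving the Cooper class at scale `t` (`t₀ < t < n`) stays within `C_W U² F(n - t)` of its scale-`t` ancestor. -/
def NonCooperFrozen (P : SplitConsts) (β U μ : ℝ) (K : TrigPolyC4v) (n : ℕ) : Prop :=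
  ∀ Ω : Fin 4 → SectorLeg (sectorCount (2 * n)), IsBGMOrdered Ω →
    (¬ IsCooperClassAt μ n P.t₀ Ω →
        ‖klIsoArray L M β U μ K klE0 n Ω - klIsoArray L M β U μ K klE0 0 (coarsen n 0 Ω)‖ ≤ P.C_W * U ^ 2) ∧
    (∀ t : ℕ, P.t₀ < t → t < n → IsCooperClassAt μ n t Ω → ¬ IsCooperClassAt μ n (t + 1) Ω →
        ‖klIsoArray L M β U μ K klE0 n Ω - klIsoArray L M β U μ K klE0 t (coarsen n t Ω)‖ ≤
          P.C_W * U ^ 2 * freezeF (n - t))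

/-- **(B4)** first moments of the quartic kernel at scale `n` ((H_n-∂), E2-NOTE §7; power `4ⁿ` confirmed by ENGINE-PRED (E4)):
for every anisotropic label 4-tuple (isotropic ones are restrictions) and every pair of legs `(i, k)`, the first moment with
leg `0` pinned at the origin is `≤ Cd · Klam · |U| · 4ⁿ`. -/
def FirstMoments (P : SplitConsts) (β U μ : ℝ) (K : TrigPolyC4v) (n : ℕ) : Prop :=
  ∀ Ω : Fin 4 → SectorLeg (sectorCount n), ∀ i k : Fin 4,
    imagTimeWeight β M ^ 3 *
        ∑ x : Fin 3 → SpaceTimeIdx L M,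
          spaceTimeDist L M β (Matrix.vecCons (0 : SpaceTimeIdx L M) x i) (Matrix.vecCons (0 : SpaceTimeIdx L M) x k) *
            ‖klAnisoLegKernel L M β U μ K klE0 n 4 Ω (Matrix.vecCons (0 : SpaceTimeIdx L M) x)‖ ≤
      P.Cd * P.Klam * |U| * (4 : ℝ) ^ n

/-- **`BetaSplitAt … G P Q K n`** = (B1) ∧ (B2) ∧ (B3) ∧ (B4) at scale `h = -n` ((B5), the scheme, is the carrier itself:
`klEffectiveAction` in the frame `K`). -/
def BetaSplitAt (G : GeoConsts) (P : SplitConsts) (Q : EngConsts) (β U μ : ℝ) (K : TrigPolyC4v) (n : ℕ) : Prop :=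
  CooperBlocksInEnvelopes L M G P Q β U μ K n ∧ EndpointNormLine L M P β U μ K n ∧
    NonCooperFrozen L M P β U μ K n ∧ FirstMoments L M P β U μ K n

/-! ## §7 `EngineBoundsAt` — (E0), (E1), (E2), (E2′), (E4) (p1's text) -/

/-- **(E0)** symmetries of the scale-`n` self-energy used by the two-leg localisation (model facts the engine's prover
establishes once): `Σ_n(-ω₀, k⃗) = conj Σ_n(ω₀, k⃗)`, spin independence, evenness and `D₄`-invariance in `k⃗`. -/
def SelfEnergySymmetric (β U μ : ℝ) (K : TrigPolyC4v) (n : ℕ) : Prop :=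
  ∀ (k : TorusSite 2 L) (σ : Fin 2),
    klSelfEnergy L M β U μ K klE0 n ((omega0 M).rev, k) σ =
        starRingEnd ℂ (klSelfEnergy L M β U μ K klE0 n (omega0 M, k) σ) ∧
    klSelfEnergy L M β U μ K klE0 n (omega0 M, k) σ = klSelfEnergy L M β U μ K klE0 n (omega0 M, k) 0 ∧
    klSelfEnergy L M β U μ K klE0 n (omega0 M, -k) σ = klSelfEnergy L M β U μ K klE0 n (omega0 M, k) σ ∧
    ∀ g : DihedralGroup 4,
      klSelfEnergy L M β U μ K klE0 n (omega0 M, d4Site g k) σ = klSelfEnergy L M β U μ K klE0 n (omega0 M, k) σ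

/-- **(E1)** kernel norms of the scale-`n` action — BGM Thm 2.1 (2.77) for OUR action, level 1 (one sector fixed, the rest
summed), ANISOTROPIC sectors, every leg number: `‖W_{2p}‖_{1,aniso} ≤ CE^p · (Klam|U|)^{max(1,p-1)} · 2^{(3p-5)n}`
(`= γ^{h(5/2 - 3p/2)}`; no `|h|`). -/
def KernelNorms (P : SplitConsts) (Q : EngConsts) (β U μ : ℝ) (K : TrigPolyC4v) (n : ℕ) : Prop :=
  ∀ p : ℕ, 1 ≤ p →
    klAnisoLegKernelNorm L M β U μ K klE0 n (2 * p) ≤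
      Q.CE ^ p * (P.Klam * |U|) ^ (max 1 (p - 1)) * (2 : ℝ) ^ ((3 * (p : ℤ) - 5) * n)

/-- **(E2)** the quartic kernel at Cooper kinematics — the SCALAR one-scale cascade comparison per `D₄` channel on p3's localised
block bottoms/tops `klLocBlockInf/Sup` (App. E (E5), FKTr2 Thm VI (ii) at `q = 0`, read through C2's `abs_formInf_sub_cascadeStep_le`
and `formInf_blockOp`): at `n = 0` the initial data `-(abot χ + c0|U|)U² ≤ blkInf 0 χ`, `blkSup 0 χ ≤ (atop χ + c0|U|)|U|`; at
`n ≥ 1` there is a bubble mass `b ∈ [blo, bhi]` with, for every `χ`,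
`cascadeStep b (blkInf (n-1) χ) - ē_n - driveBar χ n ≤ blkInf n χ` and `blkSup n χ ≤ cascadeStep b (blkSup (n-1) χ) + ē_n + drivePBar n`. -/
def CooperCascadeStep (G : GeoConsts) (P : SplitConsts) (Q : EngConsts) (β U μ : ℝ) (K : TrigPolyC4v) (n : ℕ) : Prop :=
  (n = 0 → ∀ χ : D4Irrep,
      -((G.abot χ + Q.c0 * |U|) * U ^ 2) ≤ klLocBlockInf L M β U μ K klE0 0 χ ∧
      klLocBlockSup L M β U μ K klE0 0 χ ≤ (G.atop χ + Q.c0 * |U|) * |U|) ∧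
  (1 ≤ n → ∃ b : ℝ, G.blo ≤ b ∧ b ≤ G.bhi ∧ ∀ χ : D4Irrep,
      cascadeStep b (klLocBlockInf L M β U μ K klE0 (n - 1) χ) - eremBar G P Q U β L n - driveBar G U χ n ≤
          klLocBlockInf L M β U μ K klE0 n χ ∧
      klLocBlockSup L M β U μ K klE0 n χ ≤
          cascadeStep b (klLocBlockSup L M β U μ K klE0 (n - 1) χ) + eremBar G P Q U β L n + drivePBar G P U n)

/-- **(E2′)** increments at ALL ordered isotropic 4-tuples between scales `n - 1` and `n` (`n ≥ 1`; what (B3)'s freezing consumes,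
App. E E2 (a)(d)): bounded by `(Klam U)²` times the two-shell bubble gains at the tuple's own pp / direct-ph / exchange-ph
transfers, plus the remainder majorant. -/
def IsoIncrements (G : GeoConsts) (P : SplitConsts) (Q : EngConsts) (β U μ : ℝ) (K : TrigPolyC4v) (n : ℕ) : Prop :=
  1 ≤ n → ∀ Ω : Fin 4 → SectorLeg (sectorCount (2 * n)), IsBGMOrdered Ω →
    ‖klIsoArray L M β U μ K klE0 n Ω - klIsoArray L M β U μ K klE0 (n - 1) (coarsen n (n - 1) Ω)‖ ≤
      (P.Klam * U) ^ 2 * (G.ppGain n (torusSupNorm (klPPTransfer μ n Ω)) +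
          G.phGain n (torusSupNorm (klPHTransferDirect μ n Ω)) + G.phGain n (torusSupNorm (klPHTransferExchange μ n Ω))) +
        eremBar G P Q U β L n

/-- **(E4)** first moments of the quartic kernel of the scale-`n` action (BGM (2.52)-type decay is part of the tree expansion's
output), leading constant absolute: `≤ (cE4 + cE4'|U|) · Klam · |U| · 4ⁿ` for every anisotropic 4-tuple and pair of legs. -/
def EngineFirstMoments (G : GeoConsts) (P : SplitConsts) (Q : EngConsts) (β U μ : ℝ) (K : TrigPolyC4v) (n : ℕ) : Prop :=
  ∀ Ω : Fin 4 → SectorLeg (sectorCount n), ∀ i k : Fin 4,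
    imagTimeWeight β M ^ 3 *
        ∑ x : Fin 3 → SpaceTimeIdx L M,
          spaceTimeDist L M β (Matrix.vecCons (0 : SpaceTimeIdx L M) x i) (Matrix.vecCons (0 : SpaceTimeIdx L M) x k) *
            ‖klAnisoLegKernel L M β U μ K klE0 n 4 Ω (Matrix.vecCons (0 : SpaceTimeIdx L M) x)‖ ≤
      (G.cE4 + Q.cE4 * |U|) * P.Klam * |U| * (4 : ℝ) ^ n

/-- **`EngineBoundsAt … G P Q K n`** = (E0) ∧ (E1) ∧ (E2) ∧ (E2′) ∧ (E4) at scale `h = -n` — what the fermionic tree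
expansion for OUR action delivers at scale `n` from the split at the scales `< n` ((E5): the constants are independent of
`(β, L, M, n, K)` by construction; the volume thresholds `Q.L0`, `Q.M0` are applied by the children). -/
def EngineBoundsAt (G : GeoConsts) (P : SplitConsts) (Q : EngConsts) (β U μ : ℝ) (K : TrigPolyC4v) (n : ℕ) : Prop :=
  SelfEnergySymmetric L M β U μ K n ∧ KernelNorms L M P Q β U μ K n ∧
    CooperCascadeStep L M G P Q β U μ K n ∧ IsoIncrements L M G P Q β U μ K n ∧ EngineFirstMoments L M G P Q β U μ K n

/-! ## §8 `TwoLegStepAt` — (E3): sizes, tangential floor and frame-Lipschitz bound of the scale-`n` two-leg piece -/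

/-- **(E3a)** the `|h|`-free increment sizes of the scale-`n` two-leg piece `ℓ_n(K)` (as a function on `Momentum`):
`‖Dʲ ℓ_n‖ ≤ twoLegBar j n` for `j ≤ 4`. -/
def TwoLegSizes (G : GeoConsts) (Q : EngConsts) (β U μ : ℝ) (K : TrigPolyC4v) (n : ℕ) : Prop :=
  ∀ j ≤ 4, ∀ q : Momentum,
    ‖iteratedFDeriv ℝ j (evalM (klTwoLegPiece L M β U μ K n)) q‖ ≤ twoLegBar G Q U j n

/-- **(E3b)** the per-scale TANGENTIAL FLOOR (DECOMP App. C in increments): along the level sets of the frame band inside the tube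
`{|e_K| < 3/80}`, the Hessian form of the scale-`n` piece is `≥ -bflBar n·|t|²` — two-sidedly it is only `O(U²)` (no gain), but
its negative part is summable in `n` at second order (the corner logarithm is positive) and `O(|U|³)` per scale beyond. -/
def TwoLegFloor (G : GeoConsts) (Q : EngConsts) (β U μ : ℝ) (K : TrigPolyC4v) (n : ℕ) : Prop :=
  ∀ p : Momentum, |frameLevel μ K p| < 3 / 80 → ∀ t : Momentum,
    inner ℝ (gradient (frameLevel μ K) p) t = 0 →
      -(bflBar G Q U n) * ‖t‖ ^ 2 ≤ hessQuad (evalM (klTwoLegPiece L M β U μ K n)) p t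

/-- **(E3c)** the frame-LIPSCHITZ bound of the scale-`n` piece: against any other admissible frame `K'` renormalised and split
down to the scales `< n`, `sup |ℓ_n(K) - ℓ_n(K')| ≤ lipBar n · sup |K - K'|` (the engine's `K`-derivative; `Σ_n lipBar n = O(|U|)`
makes the counterterm map a contraction). -/
def TwoLegLipschitz (G : GeoConsts) (P : SplitConsts) (Q : EngConsts) (R : RenConsts) (β U μ : ℝ) (K : TrigPolyC4v)
    (n : ℕ) : Prop :=
  ∀ K' : TrigPolyC4v, FrameOK R U (klTempScaleIdx β klE0) μ K' →
    (∀ j < n, BetaSplitAt L M G P Q β U μ K' j ∧ RenormalisedAt L M β U μ K' R j) →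
      ∀ q : Fin 2 → ℝ,
        |(klTwoLegPiece L M β U μ K n).eval q - (klTwoLegPiece L M β U μ K' n).eval q| ≤
          lipBar G Q U n * frameDist K K'

/-- **`TwoLegStepAt … G P Q R K n`** = (E3a) ∧ (E3b) ∧ (E3c): the two-leg output of the scale-`n` step in the form child 2's
inversion consumes (self-map of the frame ball + contraction) — in the CT scheme this is where DECOMP C4a's umklapp-corner
normal form (App. C) is spent. -/
def TwoLegStepAt (G : GeoConsts) (P : SplitConsts) (Q : EngConsts) (R : RenConsts) (β U μ : ℝ) (K : TrigPolyC4v)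
    (n : ℕ) : Prop :=
  TwoLegSizes L M G Q β U μ K n ∧ TwoLegFloor L M G Q β U μ K n ∧ TwoLegLipschitz L M G P Q R β U μ K n

/-- **(E3c), v2 — the frame-LIPSCHITZ bound with the engine's full history for the comparison frame** (plan g9 review
07:50:26Z Δ3; supersedes `TwoLegLipschitz`, whose `K'`-history lacks the engine bounds): against any other admissible frame `K'`
that is split, renormalised AND engine-bounded at the scales `< n` (the same history the engine step assumes for `K`; the proof
may run the expansion in both frames), `sup |ℓ_n(K) - ℓ_n(K')| ≤ lipBar n · sup |K - K'|`. -/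
def FrameLipschitz (G : GeoConsts) (P : SplitConsts) (Q : EngConsts) (R : RenConsts) (β U μ : ℝ) (K : TrigPolyC4v)
    (n : ℕ) : Prop :=
  ∀ K' : TrigPolyC4v, FrameOK R U (klTempScaleIdx β klE0) μ K' →
    (∀ j < n, BetaSplitAt L M G P Q β U μ K' j ∧ RenormalisedAt L M β U μ K' R j ∧ EngineBoundsAt L M G P Q β U μ K' j) →
      ∀ q : Fin 2 → ℝ,
        |(klTwoLegPiece L M β U μ K n).eval q - (klTwoLegPiece L M β U μ K' n).eval q| ≤
          lipBar G Q U n * frameDist K K'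

/-- **`TwoLegStep … G P Q R K n`, v2** = (E3a) `TwoLegSizes` ∧ (E3b) `TwoLegFloor` ∧ (E3c) `FrameLipschitz`: the two-leg output of the
scale-`n` step in the form child 2's inversion consumes (supersedes `TwoLegStepAt`; the children of
`KLProgrammeKLRegimeSplitChildren.lean` are stated over this one). -/
def TwoLegStep (G : GeoConsts) (P : SplitConsts) (Q : EngConsts) (R : RenConsts) (β U μ : ℝ) (K : TrigPolyC4v) (n : ℕ) : Prop :=
  TwoLegSizes L M G Q β U μ K n ∧ TwoLegFloor L M G Q β U μ K n ∧ FrameLipschitz L M G P Q R β U μ K n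

end Split

/-! ## §9 Bookkeeping lemmas -/

/-- Zero-extended coefficients of the bare frame vanish. -/
@[simp] theorem coeffExt_zero (m n : ℕ) : coeffExt 0 m n = 0 := by simp [coeffExt]

/-- `evalM` unfolds to `eval`. -/
theorem evalM_apply (A : TrigPolyC4v) (q : Momentum) : evalM A q = A.eval (WithLp.ofLp q) := rfl

/-- The two-leg piece at scale `0` is `D_0 ⊖ K`. -/
theorem klTwoLegPiece_zero (L M : ℕ) [NeZero L] [NeZero M] (β U μ : ℝ) (K : TrigPolyC4v) :
    klTwoLegPiece L M β U μ K 0 = fsub (klTwoLegPoly L M β U μ K 0) K := by simp [klTwoLegPiece]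

/-- The two-leg piece at scale `n + 1` is `D_{n+1} ⊖ D_n`. -/
theorem klTwoLegPiece_succ (L M : ℕ) [NeZero L] [NeZero M] (β U μ : ℝ) (K : TrigPolyC4v) (n : ℕ) :
    klTwoLegPiece L M β U μ K (n + 1) = fsub (klTwoLegPoly L M β U μ K (n + 1)) (klTwoLegPoly L M β U μ K n) := by
  simp [klTwoLegPiece]

end Summit.HubbardSuperconductivity.HubbardSuperconductivity.Theorems.KLRegimeSplit

end
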